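import Mathlib
import HarnessLib
import HarnessLib.Audit
import Summits.AtomisticToContinuum.Statement
import Literature.Geometry.DiscreteGeometry.KissingPatterns
import Summits.AtomisticToContinuum.Crystallization.Theorems.ReggeStarCoercivityDefectFreeCrystallizesHullCriterion
import Summits.AtomisticToContinuum.Crystallization.Theorems.ExcessDecayLiouvilleCrysEnergyLimit
import Summits.AtomisticToContinuum.Crystallization.Theorems.PhononSlackCertificatesWindowOptimality
import HarnessLib.Audit.Status.Attr

/-!
Route: BulkMatrixDichotomy

# Route BulkMatrixDichotomy — split LJ ground-state sequences by defect morphology — bulk-defective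
vs Barlow matrix

It suffices to show GenericBulkCase ∧ MatrixCase (decomp-a2c lens 2, structural dichotomy;
conjunct-level node,
a --refines child of the trivial 4-way AND `AtomisticToContinuum_iff`). Split EVERY sequence x of
N-particle
Lennard-Jones ground states by the mesoscale MORPHOLOGY of its defect set, a particle being
1/20-GOOD when its
first shell is 1/20-matched to the fcc or hcp kissing pattern (verbatim the predicate `Good` of the
PROVED crux
RobustBarlowTemplate, inlined) and BAD otherwise. GENERIC class: for every radius R, infinitely
often some
particle has ALL its R-neighbours bad (foreign bulk / porous or sub-dimensional matter / fragments
at every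
scale). MATRIX class = its negation: for some R₁, eventually every particle lies within R₁ of a good
one (a
Barlow matrix with shallow defects). GenericBulkCase: generic-class ground-state sequences have
periodic
windows; MatrixCase: matrix-class ones do ("periodic windows" = verbatim per-sequence body of
HullMinimality.PeriodicWindows). Exhaustion is excluded middle; the node sits beneath the LANDED
equivalence
Crystallization ⟺ PeriodicWindows and is EXACT (each piece is implied by Crystallization: kernel,
Necessity.lean).
Lean: `Summit.AtomisticToContinuum.Crystallization.Theses.BulkMatrixDichotomy.GenericBulkCase ∧
Summit.AtomisticToContinuum.Crystallization.Theses.BulkMatrixDichotomy.MatrixCase`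

## Assembly
Pure logic plus landed theorems (sorry-free in glue.lean / Sketch.lean): for a sequence x of ground
states, excluded middle on the
generic predicate (pushed through ∀ R, ∃ᶠ N, ∃ i, ∀ j by Filter.not_frequently) gives the
per-sequence periodic windows from one of
the two cruxes, i.e. HullMinimality.PeriodicWindows; then PrestressSplitKorn.stub_hullCriterion
(stmt-3243, PROVED) gives
IsCrystallizing, LennardJonesGroundStatesExist_holds + windowOptimality_proof (stmt-13962, PROVED)
give the optimal periodic P,
crysEnergyLimit_proof (stmt-0626, PROVED) the energy clause: closes : GenericBulkCase → MatrixCase →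
Crystallization.

Rationale: WHY THIS LINE. Every pricing route of the sub (SpectralChargeLedger.SummedShellPricing stmt-17044,
HullExactificationCascade.ZeroDefectDensity
stmt-12086, FreeSplittingCertificates.StrictSplittingRule stmt-12560, FlatToriSuffice,
LocalOrderLedger) asks ONE inequality to
price bulk-foreign matter (amorphous / polytetrahedral / bcc-like, ~0.37ε per particle above hcp:
lattice sums
[corpus:paper:arxiv-2012.05413 p.8], Stillinger2001) and shallow matrix defects (polytype / strain /
cores, 10⁻³ε scale) at once,
so tetrahedral frustration and Barlow degeneracy are entangled in a single crux. A case split on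
SEQUENCES by defect morphology
separates them into two separately typed, separately NECESSARY pieces glued by a tautology: the
matrix side is classical
defect physics of an a-priori CHARTED crystal (bulk + elastic + core decomposition,
EhrlacherOrtnerShapeev2016, Theil2006,
FlatleyTheil2015) feeding the PROVED chain hullBulkOptimal_proof → hullGoodEverywhere_proof →
shellsToLayers_proof →
LayeredHull.PeriodicGivenLayered_of; the generic side is a bulk PHASE GAP (averaged local
inequalities / LP duals, Radin1991,
HalesDSP2012) for matter with no close-packed site at any scale, where no near-degenerate competitor
of hcp lives. Imported
areas: variational theory of crystal defects (matrix side), flag-algebra / LP-dual phase gaps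
(generic side). Unlike density or
window-cooperation splits (never implied by the Statement, which asserts windows along a subsequence
only), both halves
here are consequences of Crystallization (hullCriterionConverse_proof, stmt-11780), so the node is
exact and no piece is stronger
than the target; no refuted statement (negatives 3506, 4146, 15929, 17253) is restated.

RANKED CRUXES. #2 GenericBulkCase (crux) — every sequence of Lennard-Jones ground states that has,
at every radius R and for infinitely many N, a particle all of whose R-neighbours are 1/20-bad
(first shell not 1/20-close to the fcc/hcp kissing pattern) has periodic windows (one periodic
configuration P matched two-sidedly within ε on R-balls, after translation, for infinitely many N).
Realistic proof: such sequences do not exist (bulk phase gap + cohesion + connectivity, localised by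
the hullBulkOptimal_proof / cleanLimitExtractionR_proof patterns). [difficulty: XL] (why it might
fail: an everywhere-1/20-bad bulk phase (Frank–Kasper-like or a dense glass) within o(1) of e⋆ per
particle would leave no certificate; tetrahedral frustration is exactly this regime (bcc sits 0.37ε
above, glasses 0.3–0.7ε).) [BlancLewin2015, Stillinger2001, arXiv:2012.05413, Radin1991,
HalesDSP2012]
#3 MatrixCase (crux) — every sequence of Lennard-Jones ground states in which, for some R₁,
eventually every particle lies within R₁ of a 1/20-good particle (a Barlow matrix with shallow
defects: vacancies, stacking disorder, dislocation cores, grain boundaries, surfaces, strain) has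
periodic windows. Plan: charted polytype-blind MatrixDefectPricing (bulk + elastic + core against
the local chart of the PROVED RobustBarlowTemplate) + hullBulkOptimal_proof (PROVED) ⟹ bad density →
0 in hull elements ⟹ hullGoodEverywhere / shellsToLayers patterns (PROVED) ⟹
LayeredHull.PeriodicGivenLayered_of (PROVED). [difficulty: L] (why it might fail: polycrystals with
bounded grains must be excluded, i.e. grain-boundary tension must stay chargeable down to the
low-angle Read–Shockley limit where cost per area → 0 (count dislocation cores, not area).)
[EhrlacherOrtnerShapeev2016, Theil2006, FlatleyTheil2015, BlancLewin2015]

TWO-LAYER PLAN. GenericBulkCase ⇐ BulkPhaseGap → NoPorousGroundStates → GenericBulkCase (k = 2; glue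
= localisation by the hullBulkOptimal_proof and
cleanLimitExtractionR_proof patterns + connectivity). MatrixCase ⇐ MatrixDefectPricing →
MatrixHullExactification → MatrixCase (k = 2;
the second child is the PROVED-pattern chain re-run polytype-blind). Nothing filed now.

KILL CRITERIA. Neither crux can be refuted without refuting Crystallization itself (both are implied
by it: Necessity.lean); the LINE dies if (i) an
everywhere-1/20-bad periodic configuration with energy per particle < e⋆ + 10⁻³ε is exhibited
(generic side as degenerate as the
matrix side: the split buys nothing) → close --reason exhausted; (ii) a shallow defect of relaxed
fcc/hcp Lennard-Jones with negative
clamped formation energy is certified (matrix pricing impossible) → pivot MatrixCase to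
grain-statistics (DefectBudget-type) pricing.
Proved elsewhere: SummedShellPricing (17044) or ZeroDefectDensity (12086) would moot MatrixCase and
most of GenericBulkCase.

NOT DECOMPOSED YET. The constants (1/20 goodness tolerance, 13/10 shell radius) are those of the
PROVED RobustBarlowTemplate and are not tuned; the
radius R₁ is existentially quantified per sequence; the three exclusions of the generic side (phase
gap / cohesion / connectivity)
and the two steps of the matrix side are layer-2 children, filed only after a tribunal pass;
site-energy bookkeeping (tsum over
hull elements) is deliberately kept out of the crux signatures, which speak only of finite ground
states.

CHEAPEST FALSIFIER. Lattice-sum lookup (done): optimal bcc Lennard-Jones energy −(1/2)L₆²/L₁₂ =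
−8.2373ε vs hcp −8.6111ε, fcc −8.6102ε
([corpus:paper:arxiv-2012.05413 p.8]: L₆, L₁₂ = 12.25367/9.11418 bcc, 14.45490/12.13229 hcp,
14.45392/12.13188 fcc) — the
everywhere-bad competitor nearest in kind is 0.37ε above, 400× the fcc/hcp split. Next cheapest
(kit, not run: kit_allowed=false):
minimise energy per particle over periodic configurations with ≤ 8 atoms/cell constrained to have
every site 1/20-bad.

NUMBERS. e(hcp) = −8.6111ε, e(fcc) = −8.6102ε, e(bcc) = −8.2373ε per particle at optimal density
(arXiv:2012.05413 p.8; Stillinger2001);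
goodness tolerance 1/20 and shell factor 13/10 from RobustBarlowTemplate (PROVED);
inherent-structure (glass) energies 0.3–0.7ε
above crystal (Stillinger2001).

DEFINITION REQUESTS. None: Good is inlined verbatim from
Theorems/HullExactificationCascadeRobustBarlowTemplateDefs.lean; siteEnergy / hull-element
vocabulary for the layer-2 children exists in Theses/HullExactificationCascade.lean.

Novelty: Searches (2026-08-30): tree grep over all 82 Crystallization Theses headers for
dichotomy|generic|amorphous|matrix|morpholog (hits: GappedShellCensus, SquareWellLayerCake,
DisclinationRation, SurfaceTensionNoFoam, GrandCanonicalSelection — none a sequence-class morphology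
split); lit search --hybrid "formation energy of crystal defects … decomposition elastic core" (6
textbook hits, [corpus:book:cai2016-imperfections-crystalline-solids p.152]); lit search --hybrid /
lit search "Lennard-Jones lattice sums bcc fcc hcp" (hits [corpus:paper:arxiv-2012.05413 p.8],
[corpus:paper:schwerdtfeger2024-100-years-lennard-jones-potential p.7]); lit vsearch ×2 (prose
statements: textbook hits only); lit galaxy search "defect formation energy|polycrystal|grain
boundary energy" --star all (24 rows, none relevant) and "Ehrlacher|Hudson and Ortner|crystalline
defects" --star pdf (8 rows, none relevant); ledger negatives (24 rows read).
Nearest prior art found: stmt-AtomisticToContinuum-17044 SummedShellPricing and stmt-12086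
ZeroDefectDensity (density pricing, both regimes at once, no morphology); stmt-13448
ExposedSitesCost / stmt-13682 MuGSCSolidBalls (vacuum morphology only); EhrlacherOrtnerShapeev2016
(bulk + elastic + core decomposition for ONE prescribed defect in a charted lattice — the analytic
frame of MatrixCase); Theil2006 / FlatleyTheil2015 / HeitmannRadin1980 (2D: the matrix side only,
generic side empty by kissing rigidity).
Delta: the first split of the Lennard-Jones crystallizat  [refs: book:cai2016-imperfections-crystalline-solids, paper:arxiv-2012.05413, paper:schwerdtfeger2024-100-years-lennard-jones-potential, EhrlacherOrtnerShapeev2016, Theil2006, FlatleyTheil2015, HeitmannRadin1980]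

Barriers (technique_class: case-split defect-morphology phase-gap defect-pricing): - technique_class: case-split defect-morphology phase-gap defect-pricing
- Literature.Barriers.AtomisticToContinuum.TetrahedralFrustration: inside for GenericBulkCase
(polytetrahedral bulk is generic-class) — the bet is a uniform gap κ₁ ≈ 0.3ε for matter with no
close-packed site at any scale, certifiable by averaged local inequalities because every
near-degenerate competitor of hcp (fcc, polytypes, stacking faults, strained Barlow matter) is
matrix-class; it does not bite MatrixCase (frustrated clusters cannot be shallow on all sides
without interface strain).
- Literature.Barriers.AtomisticToContinuum.IcosahedralClusters: evaded — MatrixCase prices against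
the surrounding chart and never claims the cuboctahedral 13-cluster is locally optimal;
GenericBulkCase meets icosahedral order only in bulk aggregates, where it cannot tile space (the κ₁
bet).
- Literature.Barriers.AtomisticToContinuum.DecahedralSoftShell: evaded — no piece classifies or
prices a single shell; decahedral cores inside a matrix are shallow defects priced with their strain
field.
- Literature.Barriers.AtomisticToContinuum.KissingTwelveDegeneracy: evaded — no single-shell
rigidity at tolerance is asserted; shell softness is charged to the elastic term controlled by
hullBulkOptimal_proof and bulk phonon stability.
- Literature.Barriers.AtomisticToContinuum.FlexibleKissingArrangements: evaded for the same reason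
(bulk Barlow matter has no zero modes besides rigid motions; isolated-shell flexes are not bulk mod

sub-problem: Crystallization · status: open · opened planner-decomp-a2c-lens-2-g0-0 2026-08-30T01:32:20Z · rev 0 · ledger route-AtomisticToContinuum-BulkMatrixDichotomy
GENERATED by the gate from the ledger (D-0016/17). Provers cite these decls: `theorem foo : Summit.AtomisticToContinuum.Crystallization.Theses.BulkMatrixDichotomy.<Decl> := …` in Summits/AtomisticToContinuum/Crystallization/Theorems/<Name>.lean.
-/

namespace Summit.AtomisticToContinuum.Crystallization.Theses.BulkMatrixDichotomy

open scoped BigOperators Topology Manifold Classical MeasureTheory ProbabilityTheory Matrix InnerProductSpace ComplexConjugate ContinuousMap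
open Filter Set Function TopologicalSpace MeasureTheory

attribute [summit_statement] _root_.Crystallization

/-- item stmt-AtomisticToContinuum-23839 · crux · rank 2 · open · by planner
why it might fail: an everywhere-1/20-bad bulk phase (Frank–Kasper-like or a dense glass) within o(1) of e⋆ per particle would leave no certificate; tetrahedral frustration is exactly this regime (bcc sits 0.37ε above, glasses 0.3–0.7ε).
sources: BlancLewin2015, Stillinger2001, arXiv:2012.05413, Radin1991, HalesDSP2012
[crux] every sequence of Lennard-Jones ground states that has, at every radius R and for infinitely
many N, a particle all of whose R-neighbours are 1/20-bad (first shell not 1/20-close to the fcc/hcp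
kissing pattern) has periodic windows (one periodic configuration P matched two-sidedly within ε on
R-balls, after translation, for infinitely many N). Realistic proof: such sequences do not exist
(bulk phase gap + cohesion + connectivity, localised by the hullBulkOptimal_proof /
cleanLimitExtractionR_proof patterns). [difficulty: XL] -/
@[route_item "route-AtomisticToContinuum-BulkMatrixDichotomy", crux]
def GenericBulkCase : Prop :=
  ∀ x : (N : ℕ) → (Fin N → EuclideanSpace ℝ (Fin 3)), (∀ N, Literature.MathematicalPhysics.StatisticalMechanics.IsGroundState Literature.MathematicalPhysics.StatisticalMechanics.lennardJones (x N)) → (∀ R : ℝ, ∃ᶠ N in Filter.atTop, ∃ i : Fin N, ∀ j : Fin N, dist (x N j) (x N i) ≤ R → ¬ (let d : ℝ := sInf ((fun z => dist z (x N j)) '' (Set.range (x N) \ {(x N j)})); let T : Set (EuclideanSpace ℝ (Fin 3)) := {z : EuclideanSpace ℝ (Fin 3) | z ∈ Set.range (x N) ∧ z ≠ (x N j) ∧ dist z (x N j) < 13 / 10 * d}; ∃ A : EuclideanSpace ℝ (Fin 3) →ₗᵢ[ℝ] EuclideanSpace ℝ (Fin 3), (∃ e : ↥T ≃ ↥Literature.Geometry.DiscreteGeometry.fccKissingPattern,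 ∀ t : ↥T, dist (d⁻¹ • ((t : EuclideanSpace ℝ (Fin 3)) - (x N j))) (A ((e t : ↥Literature.Geometry.DiscreteGeometry.fccKissingPattern) : EuclideanSpace ℝ (Fin 3))) ≤ 1 / 20) ∨ (∃ e : ↥T ≃ ↥Literature.Geometry.DiscreteGeometry.hcpKissingPattern, ∀ t : ↥T, dist (d⁻¹ • ((t : EuclideanSpace ℝ (Fin 3)) - (x N j))) (A ((e t : ↥Literature.Geometry.DiscreteGeometry.hcpKissingPattern) : EuclideanSpace ℝ (Fin 3))) ≤ 1 / 20))) → ∃ P : Literature.MathematicalPhysics.StatisticalMechanics.PeriodicConfiguration 3, ∀ R ε : ℝ, 0 < ε → ∃ᶠ N in Filter.atTop, ∃ t : EuclideanSpace ℝ (Fin 3), (∀ s ∈ P.points, ‖s‖ ≤ R → ∃ i : Fin N, dist (x N i + t) s ≤ ε) ∧ (∀ i : Fin N, ‖x N i + t‖ ≤ R → ∃ s ∈ P.points, dist (x N i + t) s ≤ ε)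

/-- item stmt-AtomisticToContinuum-23840 · crux · rank 3 · open · by planner
why it might fail: polycrystals with bounded grains must be excluded, i.e. grain-boundary tension must stay chargeable down to the low-angle Read–Shockley limit where cost per area → 0 (count dislocation cores, not area).
sources: EhrlacherOrtnerShapeev2016, Theil2006, FlatleyTheil2015, BlancLewin2015
[crux] every sequence of Lennard-Jones ground states in which, for some R₁, eventually every
particle lies within R₁ of a 1/20-good particle (a Barlow matrix with shallow defects: vacancies,
stacking disorder, dislocation cores, grain boundaries, surfaces, strain) has periodic windows.
Plan: charted polytype-blind MatrixDefectPricing (bulk + elastic + core against the local chart of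
the PROVED RobustBarlowTemplate) + hullBulkOptimal_proof (PROVED) ⟹ bad density → 0 in hull elements
⟹ hullGoodEverywhere / shellsToLayers patterns (PROVED) ⟹ LayeredHull.PeriodicGivenLayered_of
(PROVED). [difficulty: L] -/
@[route_item "route-AtomisticToContinuum-BulkMatrixDichotomy", crux]
def MatrixCase : Prop :=
  ∀ x : (N : ℕ) → (Fin N → EuclideanSpace ℝ (Fin 3)), (∀ N, Literature.MathematicalPhysics.StatisticalMechanics.IsGroundState Literature.MathematicalPhysics.StatisticalMechanics.lennardJones (x N)) → (∃ R₁ : ℝ, ∀ᶠ N in Filter.atTop, ∀ i : Fin N, ∃ j : Fin N, dist (x N j) (x N i) ≤ R₁ ∧ (let d : ℝ := sInf ((fun z => dist z (x N j)) '' (Set.range (x N) \ {(x N j)})); let T : Set (EuclideanSpace ℝ (Fin 3)) := {z : EuclideanSpace ℝ (Fin 3) | z ∈ Set.range (x N) ∧ z ≠ (x N j) ∧ dist z (x N j) < 13 / 10 * d}; ∃ A : EuclideanSpace ℝ (Fin 3) →ₗᵢ[ℝ] EuclideanSpace ℝ (Fin 3), (∃ e : ↥T ≃ ↥Literature.Geometry.DiscreteGeometry.fccKissingPattern,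 ∀ t : ↥T, dist (d⁻¹ • ((t : EuclideanSpace ℝ (Fin 3)) - (x N j))) (A ((e t : ↥Literature.Geometry.DiscreteGeometry.fccKissingPattern) : EuclideanSpace ℝ (Fin 3))) ≤ 1 / 20) ∨ (∃ e : ↥T ≃ ↥Literature.Geometry.DiscreteGeometry.hcpKissingPattern, ∀ t : ↥T, dist (d⁻¹ • ((t : EuclideanSpace ℝ (Fin 3)) - (x N j))) (A ((e t : ↥Literature.Geometry.DiscreteGeometry.hcpKissingPattern) : EuclideanSpace ℝ (Fin 3))) ≤ 1 / 20))) → ∃ P : Literature.MathematicalPhysics.StatisticalMechanics.PeriodicConfiguration 3, ∀ R ε : ℝ, 0 < ε → ∃ᶠ N in Filter.atTop, ∃ t : EuclideanSpace ℝ (Fin 3), (∀ s ∈ P.points, ‖s‖ ≤ R → ∃ i : Fin N, dist (x N i + t) s ≤ ε) ∧ (∀ i : Fin N, ‖x N i + t‖ ≤ R → ∃ s ∈ P.points, dist (x N i + t) s ≤ ε)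

/-- item stmt-AtomisticToContinuum-23841 · assembly · rank 1 · open · by planner
sources: BlancLewin2015
[assembly] GenericBulkCase → MatrixCase → Crystallization (the deciding theorem `closes` in
glue.lean proves exactly this, sorry-free). -/
@[route_item "route-AtomisticToContinuum-BulkMatrixDichotomy"]
def Assembly : Prop :=
  GenericBulkCase → MatrixCase → _root_.Crystallization

/-! D-0027 §2.1 — DECIDING THEOREM (planner-authored via `route open/edit --closes-file`; by planner-decomp-a2c-lens-2-g0-0 2026-08-30T01:32:20Z):
its hypotheses are this route's items and its conclusion the sub-problem Statement (glue_lint), and it elaborates with this file. -/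

@[closes "route-AtomisticToContinuum-BulkMatrixDichotomy"] theorem closes (h₁ : GenericBulkCase) (h₂ : MatrixCase) : _root_.Crystallization := by
  -- (0) case split on sequences: the two cruxes give periodic windows for EVERY sequence of ground states
  have hPW : _root_.Summit.AtomisticToContinuum.Crystallization.Theses.HullMinimality.PeriodicWindows := by
    intro x hx
    by_cases hB : ∀ R : ℝ, ∃ᶠ N in Filter.atTop, ∃ i : Fin N, ∀ j : Fin N, dist (x N j) (x N i) ≤ R →
        ¬ (let d : ℝ := sInf ((fun z => dist z (x N j)) '' (Set.range (x N) \ {(x N j)})); let T : Set (EuclideanSpace ℝ (Fin 3)) := {z : EuclideanSpace ℝ (Fin 3) | z ∈ Set.range (x N) ∧ z ≠ (x N j) ∧ dist z (x N j) < 13 / 10 * d}; ∃ A : EuclideanSpace ℝ (Fin 3) →ₗᵢ[ℝ] EuclideanSpace ℝ (Fin 3), (∃ e : ↥T ≃ ↥Literature.Geometry.DiscreteGeometry.fccKissingPattern, ∀ t : ↥T, dist (d⁻¹ • ((t : EuclideanSpace ℝ (Fin 3)) - (x N j))) (A ((e t : ↥Literature.Geometry.DiscreteGeometry.fccKissingPattern)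 : EuclideanSpace ℝ (Fin 3))) ≤ 1 / 20) ∨ (∃ e : ↥T ≃ ↥Literature.Geometry.DiscreteGeometry.hcpKissingPattern, ∀ t : ↥T, dist (d⁻¹ • ((t : EuclideanSpace ℝ (Fin 3)) - (x N j))) (A ((e t : ↥Literature.Geometry.DiscreteGeometry.hcpKissingPattern) : EuclideanSpace ℝ (Fin 3))) ≤ 1 / 20))
    · exact h₁ x hx hB
    · apply h₂ x hx
      simp only [not_forall, Filter.not_frequently, not_exists, not_not, exists_prop] at hB
      exact hB
  -- (1) positional clause: the PROVED hull criterion (stmt-3243)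
  have hpos : Literature.MathematicalPhysics.StatisticalMechanics.IsCrystallizing
      Literature.MathematicalPhysics.StatisticalMechanics.lennardJones 3 :=
    _root_.Summit.AtomisticToContinuum.Crystallization.Theorems.PrestressSplitKorn.stub_hullCriterion hPW
  -- (2) energetic clause: ground states exist (Literature), window optimality (stmt-13962), energy limit (stmt-0626)
  have hex : Literature.MathematicalPhysics.StatisticalMechanics.LennardJonesGroundStatesExist :=
    Literature.MathematicalPhysics.StatisticalMechanics.LennardJonesGroundStatesExist_holds
  obtain ⟨x, hx⟩ : ∃ x : (N : ℕ) → (Fin N → EuclideanSpace ℝ (Fin 3)), ∀ N,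
      Literature.MathematicalPhysics.StatisticalMechanics.IsGroundState
        Literature.MathematicalPhysics.StatisticalMechanics.lennardJones (x N) :=
    ⟨fun N => (hex N).choose, fun N => (hex N).choose_spec⟩
  obtain ⟨P, hP⟩ := hPW x hx
  have hleast : IsLeast (Set.range fun Q : Literature.MathematicalPhysics.StatisticalMechanics.PeriodicConfiguration 3 =>
      Q.energyPerParticle Literature.MathematicalPhysics.StatisticalMechanics.lennardJones)
      (P.energyPerParticle Literature.MathematicalPhysics.StatisticalMechanics.lennardJones) :=
    _root_.Summit.AtomisticToContinuum.Crystallization.Theorems.windowOptimality_proof x hx P hP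
  have hinf : (⨅ Q : Literature.MathematicalPhysics.StatisticalMechanics.PeriodicConfiguration 3,
      Q.energyPerParticle Literature.MathematicalPhysics.StatisticalMechanics.lennardJones) =
      P.energyPerParticle Literature.MathematicalPhysics.StatisticalMechanics.lennardJones := hleast.csInf_eq
  have hlim : Filter.Tendsto (fun N : ℕ => Literature.MathematicalPhysics.StatisticalMechanics.groundStateEnergy
      Literature.MathematicalPhysics.StatisticalMechanics.lennardJones 3 N / N) Filter.atTop
      (nhds (P.energyPerParticle Literature.MathematicalPhysics.StatisticalMechanics.lennardJones)) := by
    have hEL := _root_.Summit.AtomisticToContinuum.Crystallization.Theorems.crysEnergyLimit_proof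
    unfold Summit.AtomisticToContinuum.Crystallization.Theses.ExcessDecayLiouville.CrysEnergyLimit at hEL
    rw [hinf] at hEL
    exact hEL
  exact ⟨⟨P, hleast, hlim⟩, hpos⟩

end Summit.AtomisticToContinuum.Crystallization.Theses.BulkMatrixDichotomy
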